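import Summits.RiemannHypothesis.RiemannHypothesis.Theorems.Splittings.ScrewLatticeTowerC
import Mathlib.Algebra.Order.Field.GeomSum
import Mathlib.Data.Finset.Sum
import HarnessLib

/-!
# The rigid polygon TOWER, part E: polynomial decay of the residuals and the THIN level count

Continuation of `ScrewLatticeTowerA–C` (K-task «TOWER», cell `rh-split`, lead RULINGS #329/#354 (b)/#359 (b);
spec rh-idea-5 g2, `TowerSketch.lean` v3–v5 decay chain `resid_decay → tower_vertexMass_le →
tower_heavyCount_le`, ported here against the tree's residuals `res` of part A).  Barrier candidate B26 «TOWER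
BARRIER»: what separates the tower from a packing is not the blind model (part D, B16-bis) but the THINNESS of its
weights.  THEOREMS (ζ-free, RH-free, std axioms):

* `abs_res_le_pow` — **polynomial decay of every order**: if `2^β e^{-1/c} ≤ 1/4` and `c K₀ ≥ 1` then
  `|x_n| ≤ (K₀/n)^β` for every `n` (strong induction over the divisors; the spill weights `e^{-(q-1)/c} q^β` are
  dominated by the geometric series of ratio `2^β e^{-1/c}`).  Part A's `|x_n| ≤ 12 (c K₀)³/n²` is the case of one
  fixed exponent; here the exponent `β` is arbitrary at the price of depth `c ≤ 1/((β + 2) ln 2)`.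
* `wt_mul_level_pow_le` — hence every atom of level `n` (a vertex of gon `n`, or of the seed, level `K₀`) has
  weight `≤ e^{2/c} K₀^β / n^{β+1}`: `α_i · (level i)^{β+1} ≤ e^{2/c} K₀^β`.
* `exists_finset_level_le` — and there are at most `K₀ + (L+1)²` atoms of level `≤ L`.
* `exists_towerData_thin` — the packaged data theorem of part C (`exists_towerData`: annulus, positive summable
  weights, all holomorphic moments vanish, unattained supremum, discreteness) WITH the two thinness clauses
  (a level function `ℓ`, constants `K`, `E`: `α_i ℓ_i^{β+1} ≤ E` and `#{ℓ ≤ L} ≤ K + (L+1)²`), so that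
  `#{i : α_i ≥ a} ≤ K + ((E/a)^{1/(β+1)} + 1)²` — weight-count exponent `2/(β+1)`, as small as we please.

Part «Thin» (`ScrewLatticeTowerThin`) feeds these data to B16's model with weight-adapted aliases and gets the
blind model of part D together with a MULTIPLICITY BAND and the THIN ORDINATE COUNT `#{Im κ ≤ T} ≤ C T^e`.
Nothing here bears on the truth of RH.
-/

set_option linter.dupNamespace false

namespace Summit.RiemannHypothesis.RiemannHypothesis.Theorems.Splittings.ScrewLatticeTower

open Finset Filter Topology

noncomputable section

/-! ## 10. Polynomial decay of the residuals -/

/-- `q ≤ 2^{q-1}` for `q ≥ 1`. -/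
theorem le_two_pow_pred {q : ℕ} (hq : 1 ≤ q) : q ≤ 2 ^ (q - 1) := by
  have h := @Nat.lt_two_pow_self (q - 1)
  omega

/-- The spill weight against a polynomial: `x^{q-1} q^β ≤ (2^β x)^{q-1}` for `q ≥ 1`, `x ≥ 0`. -/
theorem pow_mul_pow_le {x : ℝ} (hx : 0 ≤ x) (β : ℕ) {q : ℕ} (hq : 1 ≤ q) :
    x ^ (q - 1) * (q : ℝ) ^ β ≤ ((2 : ℝ) ^ β * x) ^ (q - 1) := by
  have h1 : (q : ℝ) ≤ (2 : ℝ) ^ (q - 1) := by exact_mod_cast le_two_pow_pred hq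
  have h2 : (q : ℝ) ^ β ≤ ((2 : ℝ) ^ (q - 1)) ^ β := pow_le_pow_left₀ (by positivity) h1 β
  calc x ^ (q - 1) * (q : ℝ) ^ β ≤ x ^ (q - 1) * ((2 : ℝ) ^ (q - 1)) ^ β := by gcongr
    _ = ((2 : ℝ) ^ β * x) ^ (q - 1) := by rw [mul_pow, ← pow_mul, ← pow_mul, mul_comm (q - 1) β]; ring

/-- The geometric majorant of the spill series: for `y = 2^β x ≤ 1/4`,
`Σ_{m ≤ n} [2 ≤ m] m^β x^{m-1} ≤ 1/3`. -/
theorem sum_pow_mul_pow_le {x : ℝ} (hx : 0 ≤ x) (β : ℕ) (hy : (2 : ℝ) ^ β * x ≤ 1 / 4) (n : ℕ) :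
    ∑ m ∈ Finset.range (n + 1), (if 2 ≤ m then (m : ℝ) ^ β * x ^ (m - 1) else 0) ≤ 1 / 3 := by
  set y : ℝ := (2 : ℝ) ^ β * x with hy_def
  have hy0 : 0 ≤ y := by positivity
  have hy1 : y < 1 := by linarith
  -- termwise comparison with `[2 ≤ m] y^{m-1}`
  have hterm : ∀ m ∈ Finset.range (n + 1), (if 2 ≤ m then (m : ℝ) ^ β * x ^ (m - 1) else 0)
      ≤ (if 2 ≤ m then y ^ (m - 1) else 0) := by
    intro m _
    split_ifs with hm
    · rw [mul_comm]; exact pow_mul_pow_le hx β (by omega)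
    · exact le_rfl
  refine (Finset.sum_le_sum hterm).trans ?_
  rw [← Finset.sum_filter]
  have hfilter : (Finset.range (n + 1)).filter (fun m ↦ 2 ≤ m) = Finset.Ico 2 (n + 1) := by
    ext m; simp only [Finset.mem_filter, Finset.mem_range, Finset.mem_Ico]; omega
  rw [hfilter]
  -- `Σ_{2 ≤ m ≤ n} y^{m-1} = y⁻¹ Σ y^m ≤ y⁻¹ · y²/(1-y) = y/(1-y) ≤ 1/3`
  rcases hy0.eq_or_lt with hy00 | hypos
  · -- `y = 0`: every term vanishes
    have : ∀ m ∈ Finset.Ico 2 (n + 1), y ^ (m - 1) = 0 := by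
      intro m hm
      rw [Finset.mem_Ico] at hm
      rw [← hy00, zero_pow (by omega)]
    rw [Finset.sum_congr rfl this, Finset.sum_const_zero]; norm_num
  have heq : ∑ m ∈ Finset.Ico 2 (n + 1), y ^ (m - 1) = y⁻¹ * ∑ m ∈ Finset.Ico 2 (n + 1), y ^ m := by
    rw [Finset.mul_sum]
    refine Finset.sum_congr rfl fun m hm ↦ ?_
    rw [Finset.mem_Ico] at hm
    rw [show y ^ m = y ^ (m - 1) * y by rw [← pow_succ]; congr 1; omega]
    field_simp
  rw [heq]
  have hgeom := geom_sum_Ico_le_of_lt_one hy0 hy1 (m := 2) (n := n + 1)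
  calc y⁻¹ * ∑ m ∈ Finset.Ico 2 (n + 1), y ^ m ≤ y⁻¹ * (y ^ 2 / (1 - y)) :=
        mul_le_mul_of_nonneg_left hgeom (inv_nonneg.mpr hy0)
    _ = y / (1 - y) := by field_simp
    _ ≤ 1 / 3 := by
        rw [div_le_div_iff₀ (by linarith) (by norm_num : (0:ℝ) < 3)]; linarith

/-- **Polynomial decay of the residuals, every order.**  If `2^β e^{-1/c} ≤ 1/4` (e.g. `c ≤ 1/((β+2) ln 2)`) and
`c K₀ ≥ 1` then `|x_n| ≤ (K₀/n)^β` for every `n` (recall `x_n = 0` below `K₀`; `x_{K₀} = r_{K₀}^{K₀} ≤ 1`).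
Ported from rh-idea-5 g2's `TowerSketch.resid_decay` (spill hypothesis discharged by the geometric majorant). -/
theorem abs_res_le_pow {c : ℝ} (hc : 0 < c) (β : ℕ) (hy : (2 : ℝ) ^ β * Real.exp (-(1 / c)) ≤ 1 / 4)
    {K₀ : ℕ} (hK : 1 ≤ c * K₀) (n : ℕ) : |res c K₀ n| ≤ ((K₀ : ℝ) / n) ^ β := by
  set x : ℝ := Real.exp (-(1 / c)) with hxdef
  have hx0 : 0 ≤ x := (Real.exp_pos _).le
  set y : ℝ := (2 : ℝ) ^ β * x with hy_def
  have hy0 : 0 ≤ y := by positivity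
  have hy1 : y ≤ 1 := by linarith
  have hcK : 0 < c * K₀ := by linarith
  have hK1 : 1 ≤ K₀ := by
    by_contra h
    have : K₀ = 0 := by omega
    subst this; simp at hK; linarith
  have hK0r : (0 : ℝ) < K₀ := by exact_mod_cast hK1
  induction n using Nat.strong_induction_on with
  | _ n ih =>
    rcases Nat.lt_or_ge n K₀ with hn | hn
    · rw [res_of_lt hn, abs_zero]; positivity
    rcases hn.eq_or_lt with heq | hKn
    · -- `n = K₀`: `x_{K₀} = r_{K₀}^{K₀} ≤ 1`
      subst heq
      rw [res_seed, div_self hK0r.ne', one_pow, abs_of_nonneg (pow_nonneg (rad_nonneg hK) _)]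
      exact pow_le_one₀ (rad_nonneg hK) (rad_lt_one hc hK1).le
    have hn1 : 1 ≤ n := le_trans hK1 hn
    have hn0 : (0 : ℝ) < n := by exact_mod_cast hn1
    -- the target size `(K₀/n)^β` and the spill majorant `G`
    set P : ℝ := ((K₀ : ℝ) / n) ^ β with hP
    have hP0 : 0 ≤ P := by positivity
    set G : ℕ → ℝ := fun m ↦ if 2 ≤ m then (m : ℝ) ^ β * x ^ (m - 1) else 0 with hG
    have hG0 : ∀ m, 0 ≤ G m := fun m ↦ by simp only [hG]; split_ifs <;> positivity
    -- `G q ≤ y^{q-1} ≤ 1/4` for `q ≥ 2`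
    have hGy : ∀ q : ℕ, 2 ≤ q → (q : ℝ) ^ β * x ^ (q - 1) ≤ 1 / 4 := by
      intro q hq
      calc (q : ℝ) ^ β * x ^ (q - 1) = x ^ (q - 1) * (q : ℝ) ^ β := mul_comm _ _
        _ ≤ y ^ (q - 1) := pow_mul_pow_le hx0 β (by omega)
        _ ≤ y ^ 1 := pow_le_pow_of_le_one hy0 hy1 (show 1 ≤ q - 1 by omega)
        _ ≤ 1 / 4 := by rw [pow_one]; exact hy
    -- the key rescaling: for `d q = n`, `(K₀/d)^β = P · q^β`
    have hscale : ∀ d q : ℕ, d * q = n → ((K₀ : ℝ) / d) ^ β = P * (q : ℝ) ^ β := by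
      intro d q hdq
      have hdq' : (d : ℝ) * q = n := by exact_mod_cast hdq
      have hd0 : (d : ℝ) ≠ 0 := by
        intro h0; rw [h0, zero_mul] at hdq'; linarith
      have hq0 : (q : ℝ) ≠ 0 := by
        intro h0; rw [h0, mul_zero] at hdq'; linarith
      have hKd : (K₀ : ℝ) / d = (K₀ : ℝ) / n * q := by
        rw [← hdq']; field_simp
      rw [hP, ← mul_pow, hKd]
    -- the gon terms
    have hsummand : ∀ d ∈ Nat.properDivisors n,
        |(if K₀ ≤ d then term c d (res c K₀ d) n else 0)| ≤ P * G (n / d) := by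
      intro d hd
      obtain ⟨hdn, hdlt⟩ := Nat.mem_properDivisors.1 hd
      split_ifs with hKd
      · set q := n / d with hq
        have hdq : d * q = n := Nat.mul_div_cancel' hdn
        have hd1 : 1 ≤ d := le_trans hK1 hKd
        have hq2 : 2 ≤ q := by
          by_contra hlt
          interval_cases q <;> omega
        have hcd : 1 ≤ c * d := le_trans hK (by gcongr)
        have hGq : G q = (q : ℝ) ^ β * x ^ (q - 1) := by simp [hG, hq2]
        have hdecay : rad c d ^ (n - d) ≤ x ^ (q - 1) := by
          rw [← hdq]; exact rad_pow_le hcd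
        calc |term c d (res c K₀ d) n| ≤ |res c K₀ d| * rad c d ^ (n - d) := abs_term_le hcd _ _
          _ ≤ ((K₀ : ℝ) / d) ^ β * x ^ (q - 1) :=
              mul_le_mul (ih d hdlt) hdecay (pow_nonneg (rad_nonneg hcd) _) (by positivity)
          _ = P * ((q : ℝ) ^ β * x ^ (q - 1)) := by rw [hscale d q hdq]; ring
          _ = P * G (n / d) := by rw [hGq]
      · rw [abs_zero]; exact mul_nonneg hP0 (hG0 _)
    have hsumG : ∑ d ∈ Nat.properDivisors n, G (n / d) ≤ 1 / 3 := by
      calc ∑ d ∈ Nat.properDivisors n, G (n / d) ≤ ∑ d ∈ Nat.divisors n, G (n / d) :=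
            Finset.sum_le_sum_of_subset_of_nonneg (Nat.properDivisors_subset_divisors) fun _ _ _ ↦ hG0 _
        _ = ∑ d ∈ Nat.divisors n, G d := Nat.sum_div_divisors n G
        _ ≤ ∑ m ∈ Finset.range (n + 1), G m :=
            Finset.sum_le_sum_of_subset_of_nonneg (fun d hd ↦ Finset.mem_range.2
              (Nat.lt_succ_of_le (Nat.divisor_le hd))) fun _ _ _ ↦ hG0 _
        _ ≤ 1 / 3 := sum_pow_mul_pow_le hx0 β hy n
    -- the seed term: `[K₀ ∣ n] r_{K₀}ⁿ ≤ P/4`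
    have hseed : |seedMom c K₀ n| ≤ P * (1 / 4) := by
      unfold seedMom
      split_ifs with hdvd
      · obtain ⟨t, ht⟩ := hdvd
        have ht2 : 2 ≤ t := by
          by_contra hlt
          interval_cases t <;> simp at ht <;> omega
        have hKt : K₀ * t = n := ht.symm
        rw [abs_of_nonneg (pow_nonneg (rad_nonneg hK) _)]
        have h1 : rad c K₀ ^ n ≤ rad c K₀ ^ (K₀ * t - K₀) :=
          pow_le_pow_of_le_one (rad_nonneg hK) (rad_lt_one hc hK1).le (by omega)
        have h2 : rad c K₀ ^ (K₀ * t - K₀) ≤ x ^ (t - 1) := rad_pow_le hK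
        have ht0 : (0 : ℝ) < (t : ℝ) ^ β := by positivity
        have h3 : x ^ (t - 1) ≤ P * (1 / 4) := by
          have := hGy t ht2
          have hPt : P * (t : ℝ) ^ β = 1 := by
            rw [← hscale K₀ t hKt, div_self hK0r.ne', one_pow]
          calc x ^ (t - 1) = P * ((t : ℝ) ^ β * x ^ (t - 1)) := by
                rw [← mul_assoc, hPt, one_mul]
            _ ≤ P * (1 / 4) := mul_le_mul_of_nonneg_left this hP0
        exact h1.trans (h2.trans h3)
      · rw [abs_zero]; positivity
    -- assemble
    rw [res_eq hn]
    calc |seedMom c K₀ n + gonSum c K₀ n| ≤ |seedMom c K₀ n| + |gonSum c K₀ n| := abs_add_le _ _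
      _ ≤ P * (1 / 4) + ∑ d ∈ Nat.properDivisors n, |(if K₀ ≤ d then term c d (res c K₀ d) n else 0)| :=
          add_le_add hseed (Finset.abs_sum_le_sum_abs _ _)
      _ ≤ P * (1 / 4) + ∑ d ∈ Nat.properDivisors n, P * G (n / d) :=
          add_le_add le_rfl (Finset.sum_le_sum hsummand)
      _ = P * (1 / 4 + ∑ d ∈ Nat.properDivisors n, G (n / d)) := by rw [mul_add, Finset.mul_sum]
      _ ≤ P * (1 / 4 + 1 / 3) := by gcongr
      _ ≤ P := by nlinarith

/-! ## 11. Weights against levels, and the level count -/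

/-- **Thin weights**: under the decay hypothesis of `abs_res_le_pow` and `c K₀ ≥ 2`, every atom satisfies
`wt_i · (level i)^{β+1} ≤ e^{2/c} K₀^β` (seed: `(1/K₀)·K₀^{β+1} = K₀^β`; gon `n`: `|x_n|/(n r_nⁿ) · n^{β+1} ≤
e^{2/c} (K₀/n)^β n^β` by the floor `r_nⁿ ≥ e^{-2/c}`). -/
theorem wt_mul_level_pow_le {c : ℝ} (hc : 0 < c) (β : ℕ) (hy : (2 : ℝ) ^ β * Real.exp (-(1 / c)) ≤ 1 / 4)
    {K₀ : ℕ} (hK : 2 ≤ c * K₀) (i : Idx c K₀) :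
    wt c K₀ i * (level i : ℝ) ^ (β + 1) ≤ Real.exp (2 / c) * (K₀ : ℝ) ^ β := by
  have hK' : 1 ≤ c * K₀ := by linarith
  have hK1 : 1 ≤ K₀ := by
    by_contra h
    have : K₀ = 0 := by omega
    subst this; simp at hK; linarith
  have hK0r : (0 : ℝ) < K₀ := by exact_mod_cast hK1
  have he1 : 1 ≤ Real.exp (2 / c) := Real.one_le_exp (by positivity)
  rcases i with l | ⟨n, l⟩
  · simp only [wt, level]
    have hKβ : 1 / (K₀ : ℝ) * (K₀ : ℝ) ^ (β + 1) = (K₀ : ℝ) ^ β := by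
      rw [pow_succ]; field_simp
    rw [hKβ]
    exact le_mul_of_one_le_left (by positivity) he1
  · simp only [wt, level]
    have hKn := le_of_res_ne_zero n.2
    have hn2 : 2 ≤ c * n.1 := le_trans hK (by gcongr)
    have hn0 : (0 : ℝ) < n.1 := by
      have : (1 : ℝ) ≤ n.1 := by exact_mod_cast le_trans hK1 hKn
      linarith
    have hr : 0 < rad c n.1 ^ n.1 := lt_of_lt_of_le (Real.exp_pos _) (exp_le_rad_pow hc hn2)
    have hres : |res c K₀ n.1| ≤ ((K₀ : ℝ) / n.1) ^ β := abs_res_le_pow hc β hy hK' n.1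
    -- `|x_n| n^{β+1} /(n r_nⁿ) = |x_n| n^β / r_nⁿ ≤ (K₀/n)^β n^β e^{2/c} = e^{2/c} K₀^β`
    rw [div_mul_eq_mul_div, div_le_iff₀ (by positivity)]
    have hfloor := exp_le_rad_pow hc hn2
    calc |res c K₀ n.1| * (n.1 : ℝ) ^ (β + 1) ≤ ((K₀ : ℝ) / n.1) ^ β * (n.1 : ℝ) ^ (β + 1) := by gcongr
      _ = (K₀ : ℝ) ^ β * n.1 := by rw [div_pow, pow_succ]; field_simp
      _ = (K₀ : ℝ) ^ β * n.1 * (Real.exp (2 / c) * Real.exp (-(2 / c))) := by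
          rw [← Real.exp_add]; norm_num
      _ = Real.exp (2 / c) * (K₀ : ℝ) ^ β * ((n.1 : ℝ) * Real.exp (-(2 / c))) := by ring
      _ ≤ Real.exp (2 / c) * (K₀ : ℝ) ^ β * ((n.1 : ℝ) * rad c n.1 ^ n.1) := by gcongr

/-- **Level count**: at most `K₀ + (L+1)²` atoms have level `≤ L` (the `K₀` seed vertices, and `n ≤ L` vertices on
each live gon `n ≤ L`, of which there are at most `L + 1`). -/
theorem exists_finset_level_le (c : ℝ) (K₀ L : ℕ) :
    ∃ s : Finset (Idx c K₀), (∀ i, level i ≤ L → i ∈ s) ∧ s.card ≤ K₀ + (L + 1) ^ 2 := by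
  classical
  set Lv : Finset (Live c K₀) := (Finset.range (L + 1)).subtype (fun n ↦ res c K₀ n ≠ 0) with hLv
  set T : Finset (Σ n : Live c K₀, Fin n.1) := Lv.sigma (fun _ ↦ Finset.univ) with hT
  refine ⟨(Finset.univ : Finset (Fin K₀)).disjSum T, ?_, ?_⟩
  · rintro (l | ⟨n, l⟩) hi
    · exact Finset.inl_mem_disjSum.2 (Finset.mem_univ _)
    · have hn : n.1 ≤ L := hi
      refine Finset.inr_mem_disjSum.2 (Finset.mem_sigma.2 ⟨?_, Finset.mem_univ _⟩)
      show n ∈ Lv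
      rw [hLv, Finset.mem_subtype, Finset.mem_range]
      omega
  · rw [Finset.card_disjSum, Finset.card_univ, Fintype.card_fin, hT, Finset.card_sigma]
    gcongr
    have hcardLv : Lv.card ≤ L + 1 := by
      rw [hLv, Finset.card_subtype]
      exact (Finset.card_filter_le _ _).trans (Finset.card_range _).le
    calc ∑ n ∈ Lv, (Finset.univ : Finset (Fin n.1)).card = ∑ n ∈ Lv, n.1 := by
          simp only [Finset.card_univ, Fintype.card_fin]
      _ ≤ ∑ _n ∈ Lv, (L + 1) := by
          refine Finset.sum_le_sum fun n hn ↦ ?_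
          rw [hLv, Finset.mem_subtype, Finset.mem_range] at hn
          omega
      _ = Lv.card * (L + 1) := by rw [Finset.sum_const, smul_eq_mul]
      _ ≤ (L + 1) * (L + 1) := Nat.mul_le_mul_right _ hcardLv
      _ = (L + 1) ^ 2 := (sq _).symm

/-! ## 12. The packaged data theorem with the thinness clauses -/

/-- **Tower data, thin form (B26 input).**  For every `R > 1`, every exponent `β` and every depth `c > 0` with
`e^{-1/c} ≤ 1/18` and `2^β e^{-1/c} ≤ 1/4`: the rigid polygon tower with a suitable seed order, scaled into the
open annulus `1 < ‖w‖ < R`, is a countable family of atoms with POSITIVE summable weights ALL of whose holomorphic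
moments vanish, with unattained supremum of moduli, DISCRETE in the annulus — the clause list of
`exists_towerData` — AND THIN: there are a level function `ℓ : ι → ℕ` and constants `K : ℕ`, `E : ℝ` with
`α_i · ℓ_i^{β+1} ≤ E` for every atom and at most `K + (L+1)²` atoms of level `≤ L` for every `L`; consequently
`#{i : α_i ≥ a} ≤ K + ((E/a)^{1/(β+1)} + 1)²` for every `a > 0` (weight-count exponent `2/(β+1)`). -/
theorem exists_towerData_thin {R : ℝ} (hR : 1 < R) {c : ℝ} (hc : 0 < c) (hx : Real.exp (-(1 / c)) ≤ 1 / 18)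
    (β : ℕ) (hy : (2 : ℝ) ^ β * Real.exp (-(1 / c)) ≤ 1 / 4) :
    ∃ (ι : Type) (_ : Countable ι) (w : ι → ℂ) (α : ι → ℝ) (ℓ : ι → ℕ) (K : ℕ) (E : ℝ),
      Nonempty ι ∧ (∀ i, 1 < ‖w i‖ ∧ ‖w i‖ < R) ∧ (∀ i, 0 < α i) ∧ Summable α ∧
      (∀ k : ℕ, 1 ≤ k → HasSum (fun i ↦ (α i : ℂ) * w i ^ k) 0) ∧
      (∀ i, ∃ j, ‖w i‖ < ‖w j‖) ∧
      (∀ ρ < R, {i | ‖w i‖ ≤ ρ}.Finite) ∧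
      (∀ i, α i * (ℓ i : ℝ) ^ (β + 1) ≤ E) ∧
      (∀ L : ℕ, ∃ s : Finset ι, (∀ i, ℓ i ≤ L → i ∈ s) ∧ s.card ≤ K + (L + 1) ^ 2) := by
  have hR0 : 0 < R := by linarith
  have hρ : 1 / R < 1 := by rw [div_lt_one hR0]; exact hR
  -- seed order: `c K₀ ≥ 2` and `r_{K₀} > 1/R`
  obtain ⟨N₁, _, hN₁⟩ := exists_rad_gt hc hρ 0
  obtain ⟨K₀, hK₀⟩ := exists_nat_ge (max (N₁ : ℝ) (2 / c))
  have hKN : N₁ ≤ K₀ := by exact_mod_cast (le_max_left _ _).trans hK₀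
  have hK2 : 2 ≤ c * K₀ := by
    have := (le_max_right _ _).trans hK₀
    rw [div_le_iff₀ hc] at this; linarith
  have hK' : 1 < c * K₀ := by linarith
  have hK1 : 1 ≤ K₀ := by
    by_contra h
    have : K₀ = 0 := by omega
    subst this; simp at hK2; linarith
  have hN1 : 1 ≤ N₁ := by
    by_contra h
    have : N₁ = 0 := by omega
    subst this
    simp [rad] at hN₁
    have : 0 < 1 / R := by positivity
    linarith
  refine ⟨Idx c K₀, inferInstance, fun i ↦ (R : ℂ) * atom c K₀ i, wt c K₀, level, K₀,
    Real.exp (2 / c) * (K₀ : ℝ) ^ β, ⟨Sum.inl ⟨0, by omega⟩⟩, ?_,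
    wt_pos hc hK', summable_wt hc hx hK2, ?_, ?_, ?_, wt_mul_level_pow_le hc β hy hK2,
    exists_finset_level_le c K₀⟩
  · intro i
    rw [norm_mul, Complex.norm_real, Real.norm_eq_abs, abs_of_pos hR0, norm_atom hc hK']
    constructor
    · have h1 : rad c N₁ ≤ rad c (level i) := rad_le_rad hc hN1 (hKN.trans (le_level i))
      rw [div_lt_iff₀ hR0] at hN₁
      calc (1 : ℝ) < rad c N₁ * R := hN₁
        _ ≤ rad c (level i) * R := by gcongr
        _ = R * rad c (level i) := mul_comm _ _
    · have hlt : rad c (level i) < 1 := rad_lt_one hc (le_trans hK1 (le_level i))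
      calc R * rad c (level i) < R * 1 := by gcongr
        _ = R := mul_one R
  · intro k hk
    have h := (hasSum_moment hc hx hK2 hk).mul_left ((R : ℂ) ^ k)
    rw [mul_zero] at h
    have hfun : (fun i : Idx c K₀ ↦ ((wt c K₀ i : ℝ) : ℂ) * ((R : ℂ) * atom c K₀ i) ^ k)
        = fun i ↦ (R : ℂ) ^ k * ((wt c K₀ i : ℂ) * atom c K₀ i ^ k) := by
      funext i; ring
    rw [hfun]
    exact h
  · intro i
    obtain ⟨j, hj⟩ := exists_norm_lt hc hK' i
    refine ⟨j, ?_⟩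
    rw [norm_mul, norm_mul]
    gcongr
    rw [Complex.norm_real, Real.norm_eq_abs, abs_of_pos hR0]; exact hR0
  · intro ρ hρR
    have hρ' : ρ / R < 1 := by rw [div_lt_one hR0]; exact hρR
    refine (finite_norm_le hc hK' hρ').subset fun i hi ↦ ?_
    simp only [Set.mem_setOf_eq] at hi ⊢
    rw [norm_mul, Complex.norm_real, Real.norm_eq_abs, abs_of_pos hR0] at hi
    rw [le_div_iff₀ hR0]; linarith

end

end Summit.RiemannHypothesis.RiemannHypothesis.Theorems.Splittings.ScrewLatticeTower
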